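import Mathlib
import Literature.Analysis.FluidPDE.SelfSimilarEulerProfile
import HarnessLib

/-!
# Classical pressures of one profile differ by constants: the `∀ P′` / `∃ P′` quantifier of the channel and piercing binders is immaterial
# (crux `EulerZoomLiouville.PowerGaugeEulerLiouville` = stmt-NavierStokesRegularity-19832, line `birth`, THE ONE STATEMENT; LEAD's RESIDUE-MEMO-19832-g12 target T4)

Route №10 `EulerZoomLiouville` (NavierStokesRegularity); width seat ns-ezl-w5 g2.  THE ONE STATEMENT's dynamical binders (`HasBernoulliPiercing`,
`HasPinchedVorticalChannel` / the growth-free channel of `…SqueezeFreeMember`, …) quantify over EVERY classical pressure `P′` of the profile `V`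
(`IsSelfSimilarEulerProfile γ 0 V P′`).  Two classical pressures of the same profile have the same gradient (CIV (3.3): `∇P′ = −(1−γ)V − DV[γy + V]`), hence differ
by a constant, so the Bernoulli functions differ by the same constant and every LEVEL-QUANTIFIED condition (`∀ h, …{ℋ_{P′} > h}…`) holds for all classical pressures as
soon as it holds for one.  Typed here once, so that the binders may be read with `∃ P′` (T4 of the LEAD's memo):

* `Loc.pressure_eq_add_const_of_profile` — `IsSelfSimilarEulerProfile γ c U P₁ → IsSelfSimilarEulerProfile γ c U P₂ → ∃ k, ∀ y, P₂ y = P₁ y + k`.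
* `Loc.selfSimilarBernoulli_eq_add_const_of_profile` — the same constant shifts `ℋ`.
* `Loc.vorticalChannel_forall_of_exists` — the one-sided far vortical channel condition (any rate `c₁`, level by level) transfers from one classical pressure to all.
* `Loc.bernoulliPiercing_forall_of_exists` — likewise for Bernoulli piercing on spheres.

HONEST LABEL: bookkeeping for THE ONE STATEMENT's binders.  WHAT THIS IS NOT: not NS, not E — 19832 is a crux CLASS on the MODEL lattice (E/NS strata) and stays OPEN;
NS regularity is NOT proved. [cite: ConstantinIgnatovaVicol2026Putative, §3.1.1 eq. (3.3), §3.4.3 eq. (3.30)]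
-/

noncomputable section

-- flat `Theorems/<Route><Decl>…` files of one crux share the namespace of the crux (tree convention)
set_option linter.dupNamespace false

open Set Filter Topology Metric Function InnerProductSpace
open scoped RealInnerProductSpace

namespace Summit.NavierStokesRegularity.NavierStokesRegularity.Theorems.PowerGaugeEulerLiouville.Loc

open Literature.Analysis Literature.Analysis.FluidPDE

variable {γ : ℝ} {c : EuclideanSpace ℝ (Fin 3)} {U : EuclideanSpace ℝ (Fin 3) → EuclideanSpace ℝ (Fin 3)}
  {P₁ P₂ : EuclideanSpace ℝ (Fin 3) → ℝ}

/-- **Two classical pressures of one profile differ by a constant**: `IsSelfSimilarEulerProfile γ c U P₁`, `IsSelfSimilarEulerProfile γ c U P₂` ⇒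
`∃ k, ∀ y, P₂ y = P₁ y + k` (same gradient by CIV (3.3); `ℝ³` is connected). [cite: ConstantinIgnatovaVicol2026Putative, §3.1.1 eq. (3.3)] -/
theorem pressure_eq_add_const_of_profile (h₁ : IsSelfSimilarEulerProfile γ c U P₁) (h₂ : IsSelfSimilarEulerProfile γ c U P₂) :
    ∃ k : ℝ, ∀ y : EuclideanSpace ℝ (Fin 3), P₂ y = P₁ y + k := by
  have hd₁ : Differentiable ℝ P₁ := h₁.differentiable_pressure
  have hd₂ : Differentiable ℝ P₂ := h₂.differentiable_pressure
  have hgrad : ∀ y, gradient P₂ y = gradient P₁ y := by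
    intro y
    have e₁ := h₁.profile_eq y
    have e₂ := h₂.profile_eq y
    have : gradient P₁ y = -((1 - γ) • U y + fderiv ℝ U y (γ • (y - c) + U y)) := eq_neg_of_add_eq_zero_right e₁
    rw [this]
    exact eq_neg_of_add_eq_zero_right e₂
  have hfd : ∀ y, fderiv ℝ (fun z => P₂ z - P₁ z) y = 0 := by
    intro y
    rw [fderiv_fun_sub (hd₂ y) (hd₁ y)]
    have h1 : fderiv ℝ P₂ y = fderiv ℝ P₁ y := by
      have := hgrad y
      unfold gradient at this
      exact (InnerProductSpace.toDual ℝ (EuclideanSpace ℝ (Fin 3))).symm.injective this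
    rw [h1, sub_self]
  refine ⟨P₂ 0 - P₁ 0, fun y => ?_⟩
  have := is_const_of_fderiv_eq_zero (hd₂.sub hd₁) hfd y 0
  simp only [Pi.sub_apply] at this
  linarith

/-- The Bernoulli functions of two classical pressures of one profile differ by the same constant. [cite: ConstantinIgnatovaVicol2026Putative, §3.4.3 eq. (3.30)] -/
theorem selfSimilarBernoulli_eq_add_const_of_profile (h₁ : IsSelfSimilarEulerProfile γ c U P₁) (h₂ : IsSelfSimilarEulerProfile γ c U P₂) :
    ∃ k : ℝ, ∀ y : EuclideanSpace ℝ (Fin 3), selfSimilarBernoulli γ c U P₂ y = selfSimilarBernoulli γ c U P₁ y + k := by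
  obtain ⟨k, hk⟩ := pressure_eq_add_const_of_profile h₁ h₂
  refine ⟨k, fun y => ?_⟩
  simp only [selfSimilarBernoulli_apply, hk y]
  ring

/-- **The far vortical channel condition does not depend on the classical pressure** (T4): if for ONE classical pressure `P₁` of `U` and every level `h` there is a
radius beyond which every vortical point of `{ℋ_{P₁} > h}` satisfies `⟪y, W y⟫ ≤ −c₁‖y‖²` (`W` any fixed field, e.g. `γy + U y`), then the same holds for EVERY
classical pressure `P₂` (the level shifts by the constant `P₂ − P₁`). [cite: ConstantinIgnatovaVicol2026Putative, §3.4.3 eq. (3.30)] -/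
theorem vorticalChannel_forall_of_exists {W : EuclideanSpace ℝ (Fin 3) → EuclideanSpace ℝ (Fin 3)} {c₁ : ℝ}
    (h₁ : IsSelfSimilarEulerProfile γ c U P₁)
    (hch : ∀ h : ℝ, ∃ R₀ : ℝ, ∀ y : EuclideanSpace ℝ (Fin 3), R₀ ≤ ‖y‖ → h < selfSimilarBernoulli γ c U P₁ y →
      curl U y ≠ 0 → ⟪y, W y⟫ ≤ -(c₁ * ‖y‖ ^ 2))
    (h₂ : IsSelfSimilarEulerProfile γ c U P₂) (h : ℝ) :
    ∃ R₀ : ℝ, ∀ y : EuclideanSpace ℝ (Fin 3), R₀ ≤ ‖y‖ → h < selfSimilarBernoulli γ c U P₂ y →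
      curl U y ≠ 0 → ⟪y, W y⟫ ≤ -(c₁ * ‖y‖ ^ 2) := by
  obtain ⟨k, hk⟩ := selfSimilarBernoulli_eq_add_const_of_profile h₁ h₂
  obtain ⟨R₀, hR₀⟩ := hch (h - k)
  refine ⟨R₀, fun y hy hH hc => hR₀ y hy ?_ hc⟩
  rw [hk y] at hH
  linarith

/-- **Bernoulli piercing does not depend on the classical pressure** (T4): if for ONE classical pressure `P₁` every level `h` and bound `R₀` admit a sphere beyond `R₀`
all of whose fast-inflow points are irrotational or have `ℋ_{P₁} < h`, then the same holds for EVERY classical pressure `P₂`.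
[cite: ConstantinIgnatovaVicol2026Putative, §3.4.3 eq. (3.30)] -/
theorem bernoulliPiercing_forall_of_exists {a : ℝ}
    (h₁ : IsSelfSimilarEulerProfile γ c U P₁)
    (hp : ∀ h R₀ : ℝ, ∃ R : ℝ, R₀ ≤ R ∧ ∀ y : EuclideanSpace ℝ (Fin 3), ‖y‖ = R → inner ℝ y (U y) ≤ -(a * ‖y‖ ^ 2) →
      (curl U y = 0 ∨ selfSimilarBernoulli γ c U P₁ y < h))
    (h₂ : IsSelfSimilarEulerProfile γ c U P₂) (h R₀ : ℝ) :
    ∃ R : ℝ, R₀ ≤ R ∧ ∀ y : EuclideanSpace ℝ (Fin 3), ‖y‖ = R → inner ℝ y (U y) ≤ -(a * ‖y‖ ^ 2) →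
      (curl U y = 0 ∨ selfSimilarBernoulli γ c U P₂ y < h) := by
  obtain ⟨k, hk⟩ := selfSimilarBernoulli_eq_add_const_of_profile h₁ h₂
  obtain ⟨R, hR, hsph⟩ := hp (h - k) R₀
  refine ⟨R, hR, fun y hy hfast => ?_⟩
  rcases hsph y hy hfast with h0 | hlt
  · exact Or.inl h0
  · right
    rw [hk y]
    linarith

end Summit.NavierStokesRegularity.NavierStokesRegularity.Theorems.PowerGaugeEulerLiouville.Loc

end
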